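import Summits.QuantumFields.YangMills.Theorems.LuscherReductionTwistedTraceScalingWindowFloor
import Summits.QuantumFields.YangMills.Theorems.LuscherReductionTwistedTraceScalingValleyLogRecord
import HarnessLib

/-!
# ★★★★★ Registered stub S-BASE `stub_fixedLatticeTraceLaw : Stmt.stub_fixedLatticeTraceLaw` of line «twolattice» skeleton rev 3 (crux `TwistedTraceScaling`,
# stmt-QuantumFields-20203) — BY NAME AND SIGNATURE, UNCONDITIONAL: the zero-flux dyadic trace ratio of Wilson's `SU(2)` theory on `(ℤ/L₁)³` at
# `T = ⌈sL₁/Λ(β,L₁)⌉` transfer steps tends to Lüscher's `r_𝔥(s)` as `β → ∞`, for EVERY fixed lattice size `L₁`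

Route `LuscherReduction` (owner ym-beyond-p1), crux `TwistedTraceScaling` (stmt-QuantumFields-20203), line «twolattice», skeleton rev 3 (`pub/ym-beyond/p1-g29-files/Lines-twolattice-r3.lean`,
sha16 1a2ae9b1ae61a9c5; stubs S-BASE · CMP-2LOOP · TRACK).  Fleet base ym-luscher-20007-p1 (lane A of S-BASE), lead g24; card `pub/ym-fleet/ym-luscher-20007-p1/Lines-window-floor.md`.
The gate credits the VERBATIM header `theorem stub_fixedLatticeTraceLaw : Stmt.stub_fixedLatticeTraceLaw := …`; as for ✓`stub_oneSiteTraceLimit` (`…StubOneSiteTraceLimit`) and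
✓`stub_labelTracking` (`…TrackStub`), the statement abbreviation is re-homed CHARACTER FOR CHARACTER under the Theorems-side namespace `…Theorems.FemtoTransferGap.TwoLattice` (the skeleton
is not importable from `Theorems/`; the two `Stmt.*` are syntactically identical under the same `open`s, so the owner's discharge in the skeleton is
`theorem stub_fixedLatticeTraceLaw : Stmt.stub_fixedLatticeTraceLaw := Summit.QuantumFields.YangMills.Theorems.FemtoTransferGap.TwoLattice.stub_fixedLatticeTraceLaw`).

PROOF (the whole COARSE programme of this lineage, 2026-08-27 → 08-30): S-BASE ⟸ COARSE-UPPER(L₁) ∧ COARSE-LOWER(L₁) ∧ W(L₁) at every `L₁` (✓`Base.stmt_of_window` over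
✓`ConstTube.coarseUpper`, ✓`ConstTube.coarseLower`, `L₁ = 1` = crux ONE + the closed child `OneSiteTail`); W(L₁), the `k`-UNIFORM lattice window floor, is ✓`ConstTube.windowFloor_of_valleyLog`
(the `k`-uniform Born–Oppenheimer window from the (B-T)/(B-ST)/(B-OD)/(B-N) record + the refined onion run once for all levels + ✓`OST.windowFloor_all` at `B = L³β` + labels) fed with the
LOG-RATE valley gain ✓`ConstTube.valleyGainLog_record` at radius `β^{−19/100}` (hand w1 g3: RED's weak BO valley + geometry with rate, nine thin log-shells).
HONEST FRAMING: a theorem about a FIXED lattice size, eventually in `β` (astronomical, `L`-dependent thresholds) — finite-dimensional semiclassics of the zero-flux transfer operator;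
it closes ONE of the three registered stubs of line «twolattice» (`stub_labelTracking` ✓, `stub_cmpTwoLoop` — the two-lattice RG comparison — OPEN); the crux `TwistedTraceScaling`
stays OPEN; the route R2b1 (Lüscher two-lattice reduction) is CONDITIONAL; nothing here is infinite volume, a mass gap, or Clay.  No named facts, no `sorry`.
-/

set_option autoImplicit false

noncomputable section

namespace Summit.QuantumFields.YangMills.Theorems.FemtoTransferGap.TwoLattice

open Summit.QuantumFields.YangMills.Theorems.FemtoTransferGap
open Summit.QuantumFields.YangMills.Theorems.FemtoTransferGap.TraceDoor

/-- S-BASE statement (VERBATIM `TwoLattice.Stmt.stub_fixedLatticeTraceLaw` of the registered skeleton rev 3, sha16 1a2ae9b1ae61a9c5 = revs 1/2 text): fixed lattice,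
`β → ∞` — the zero-flux dyadic trace ratio at `T = ⌈sL₁/Λ(β,L₁)⌉` tends to Lüscher's `r_𝔥(s)`.  Proved below (`stub_fixedLatticeTraceLaw`, which carries the citations); this
abbreviation is a re-homed skeleton statement text over Summits-side objects (`traceRatio`, `femtoSteps`, `hTraceRatio`), deliberately WITHOUT a citation tag. -/
abbrev Stmt.stub_fixedLatticeTraceLaw : Prop :=
  ∀ (L1 : ℕ) [NeZero L1] (s : ℝ), 0 < s → ∀ ε : ℝ, 0 < ε → ∃ β1 : ℝ, ∀ β : ℝ, β1 ≤ β →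
    |traceRatio L1 β (femtoSteps s β L1) - hTraceRatio s| ≤ ε

/-- ★★★★★ **Registered stub S-BASE of line «twolattice», BY NAME, unconditional**: for every fixed lattice size `L₁`, femto time `s > 0` and `ε > 0` there is `β₁` such that for all
`β ≥ β₁` the zero-flux dyadic trace ratio `traceRatio L₁ β ⌈sL₁/Λ(β,L₁)⌉` is within `ε` of Lüscher's `r_𝔥(s) = Σ_k e^{−2sΔ_k}/(Σ_k e^{−sΔ_k})²`.  Proof: ✓`ConstTube.stmt_of_valleyLog`
(COARSE-UPPER ✓, COARSE-LOWER ✓, the `k`-uniform window floor W(L₁) ✓ modulo the log-rate valley gain) at ✓`ConstTube.valleyGainLog_record` (`a = 19/100`).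
[cite: Luscher1983, §3] [cite: LuscherMunster1984, §2] [cite: KollerVanbaal1986] [cite: Simon1983, Thm 1.1] -/
theorem stub_fixedLatticeTraceLaw : Stmt.stub_fixedLatticeTraceLaw :=
  ConstTube.stmt_of_valleyLog fun L1 _ hL1 => ConstTube.valleyGainLog_record (L := L1) hL1 (a := 19 / 100) (by norm_num) (by norm_num)

end Summit.QuantumFields.YangMills.Theorems.FemtoTransferGap.TwoLattice

end
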